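import Mathlib
import Summits.Ventures.PercRepro.TriangleCapClosedForm

/-!
# PercRepro — THE CLOSED FORM IN THE COORDINATES `(k, m)`: EVERY CELL `2k − 3 ≤ m ≤ ⌊k²/4⌋` (p3, gen 40; part 163)

Every `m` with `2k − 3 ≤ m ≤ ⌊k²/4⌋` is `a (k − a) − r` for the least `a ≥ 3` with `a (k − a) ≥ m`, and then
`2a + r ≤ k` (`exists_cell`: the previous product `(a − 1)(k − a + 1)` lies below `m`). Hence
**`closed_form_km (k m) (hk : 6 ≤ k) (hm1 : 2k ≤ m + 3) (hm2 : 4m ≤ k²)`**: there is `r` (the distance of `m` to the nearest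
product `a (k − a)` above it) with `r ≤ k` such that the maximum of `2·Σ_v C(d(v), 2)` over the `K₄⁻`-free
graphs on `Fin k` with `m` edges is `m (k − 2) − r (k − 1 − r)` — the closed form of §10av on the whole dense
corner, in the coordinates of the cherry table. Axioms: standard.
-/

namespace PercRepro

namespace TriangleCap

namespace C047

open Finset

/-- `⌊k/2⌋ · ⌈k/2⌉ = ⌊k²/4⌋ ≥ m` when `4m ≤ k²`: the middle product dominates every `m` of the dense corner. -/
theorem le_mid_prod (k m : ℕ) (hm2 : 4 * m ≤ k * k) : m ≤ (k / 2) * (k - k / 2) := by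
  obtain ⟨h, hh⟩ : ∃ h, k = 2 * h ∨ k = 2 * h + 1 := ⟨k / 2, by omega⟩
  rcases hh with rfl | rfl
  · have e1 : 2 * h / 2 = h := by omega
    have e2 : 2 * h - h = h := by omega
    rw [e1, e2]
    nlinarith
  · have e1 : (2 * h + 1) / 2 = h := by omega
    have e2 : 2 * h + 1 - h = h + 1 := by omega
    rw [e1, e2]
    nlinarith

/-- **EVERY `m` OF THE DENSE CORNER IS A CELL:** `2k − 3 ≤ m ≤ ⌊k²/4⌋` ⇒ `∃ a r, 3 ≤ a ∧ 2a + r ≤ k ∧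
a (k − a) = m + r` (the least `a ≥ 3` with `a (k − a) ≥ m`). -/
theorem exists_cell (k m : ℕ) (hk6 : 6 ≤ k) (hm1 : 2 * k ≤ m + 3) (hm2 : 4 * m ≤ k * k) :
    ∃ a r, 3 ≤ a ∧ 2 * a + r ≤ k ∧ a * (k - a) = m + r := by
  have hex : ∃ a, 3 ≤ a ∧ m ≤ a * (k - a) := ⟨k / 2, by omega, le_mid_prod k m hm2⟩
  classical
  obtain ⟨a, ha, hmin⟩ : ∃ a, (3 ≤ a ∧ m ≤ a * (k - a)) ∧ ∀ a', a' < a → ¬ (3 ≤ a' ∧ m ≤ a' * (k - a')) :=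
    ⟨Nat.find hex, Nat.find_spec hex, fun a' h => Nat.find_min hex h⟩
  refine ⟨a, a * (k - a) - m, ha.1, ?_, by omega⟩
  -- `2a + r ≤ k`: the previous product `(a − 1)(k − a + 1)` is below `m`
  by_contra hcon
  push Not at hcon
  -- `a ≤ k / 2` (the middle product is a witness, so the least `a` is at most `k / 2`)
  have hak : a ≤ k / 2 := by
    by_contra h
    push Not at h
    exact hmin (k / 2) h ⟨by omega, le_mid_prod k m hm2⟩
  rcases Nat.lt_or_ge a 4 with h3 | h4
  · -- `a = 3`: `2 · 3 + r ≤ k` would fail only if `r > k − 6`, but `3 (k − 3) − m ≤ 3 (k − 3) − (2k − 3) = k − 6`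
    have ha3 : a = 3 := by omega
    rw [ha3] at hcon ha
    omega
  · -- `a ≥ 4`: `(a − 1)(k − a + 1) < m ≤ a (k − a)` bounds `r = a (k − a) − m < k − 2a + 1`
    have hprev := hmin (a - 1) (by omega)
    push Not at hprev
    have hlt : (a - 1) * (k - (a - 1)) < m := hprev (by omega)
    obtain ⟨a', ha'⟩ : ∃ a', a = a' + 1 := ⟨a - 1, by omega⟩
    obtain ⟨c, hc⟩ : ∃ c, k = a' + 1 + c := ⟨k - (a' + 1), by omega⟩
    rw [ha', hc] at hlt ha hcon
    have e1 : a' + 1 - 1 = a' := by omega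
    have e2 : a' + 1 + c - a' = c + 1 := by omega
    have e3 : a' + 1 + c - (a' + 1) = c := by omega
    rw [e1, e2] at hlt
    rw [e3] at ha hcon
    -- `a' (c + 1) < m ≤ (a' + 1) c` and `2 (a' + 1) + ((a' + 1) c − m) > a' + 1 + c`
    have h1 : (a' + 1) * c = a' * c + c := by ring
    have h2 : a' * (c + 1) = a' * c + a' := by ring
    omega

/-- **THE CLOSED FORM IN THE COORDINATES `(k, m)`:** for every `m` with `2k − 3 ≤ m ≤ ⌊k²/4⌋` there is
`r ≤ k` — the distance of `m` to the nearest product `a (k − a)` above it — such that the maximum of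
`2·Σ_v C(d(v), 2)` over the `K₄⁻`-free graphs on `Fin k` with `m` edges is `m (k − 2) − r (k − 1 − r)`. -/
theorem closed_form_km (k m : ℕ) (hk6 : 6 ≤ k) (hm1 : 2 * k ≤ m + 3) (hm2 : 4 * m ≤ k * k) :
    ∃ r, r ≤ k ∧ (∃ a, 3 ≤ a ∧ 2 * a + r ≤ k ∧ a * (k - a) = m + r) ∧
      (∀ (D : SimpleGraph (Fin k)) [DecidableRel D.Adj], K4mFree D → D.edgeFinset.card = m →
        2 * cherries D + r * (k - 1 - r) ≤ m * (k - 2)) ∧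
      ∃ (D : SimpleGraph (Fin k)) (_ : DecidableRel D.Adj), K4mFree D ∧
        D.edgeFinset.card = m ∧ 2 * cherries D + r * (k - 1 - r) = m * (k - 2) := by
  obtain ⟨a, r, ha, hak, hm⟩ := exists_cell k m hk6 hm1 hm2
  have h := closed_form_exact_k4m k a r ha hak
  have e : a * (k - a) - r = m := by omega
  rw [e] at h
  exact ⟨r, by omega, ⟨a, ha, hak, hm⟩, h.1, h.2⟩

end C047

end TriangleCap

end PercRepro
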